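import Summits.PneNP.PneNP.Theorems.CliqueExtLowerBound.Negative.LargeCliquesMonotone

/-!
# Polynomial-size monotone circuits for threshold functions (door side of route NegLimited, stmt-PneNP-19860)

Helper file for the door item `NegLimited.NeglimitedEpsLogNegationsR` (stmt-PneNP-19860, line
`correlation-door`, ROUND-8 §B.2 test (4)(b)): the tightness witness for the open crux
`PlantedCliqueMonotoneAdvantageQuart` is the EDGE-COUNT THRESHOLD, so we need the folklore fact that
the threshold function `Thr_θ(x) = [#{i | xᵢ = 1} ≥ θ]` of `N` variables has a `{∧₂, ∨₂}`-circuit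
with `O(N·θ)` gates (`exists_monotone_circuit_thrFn`: at most `θ + N·2θ` gates, `1 ≤ θ ≤ N`).

Construction (the counter): process the inputs `x₀, …, x_{N-1}` one at a time, keeping the `θ`
level bits `ℓ_j^{(i)} = [#{t < i | x_t = 1} ≥ j + 1]` (`j < θ`); the update is
`ℓ_j^{(i+1)} = ℓ_j^{(i)} ∨ (ℓ_{j-1}^{(i)} ∧ x_i)` (`ℓ_0^{(i+1)} = ℓ_0^{(i)} ∨ x_i`), two gates per level,
and the output is `ℓ_{θ-1}^{(N)}`.  The straight-line program is assembled in the tree's size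
calculus `CktSize` (`CircuitComposition.lean`: `pair`, `comp`, `pi_const`, `outMap`, `rewire`,
`toCircuit`) over the basis `{∧₂, ∨₂, 0, 1}` (the initial level bits are the constant `0`; bricks
`MonoBasis`, `cktSize_const01`, `cktSize_or2'`, `cktSize_and2'` of
`CliqueExtLowerBound/Negative/LargeCliquesMonotone.lean`), and the constants are removed by the tree's
constant elimination `GateList.const_or_exists_monotone_circuit` (the threshold function is not
constant for `1 ≤ θ ≤ N`).

References: I. Wegener, *The Complexity of Boolean Functions* (1987), Ch. 3 (threshold functions
have linear-size-per-level monotone circuits); S. Jukna, *Boolean Function Complexity* (2012), §1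
[Jukna2012].
-/

set_option linter.dupNamespace false -- `Summit.PneNP.PneNP.…`: summit = sub-problem name (D-0017 single-conjunct layout)

namespace Summit.PneNP.PneNP.Theorems.NegLimitedDoor.Threshold

open Finset
open Literature.Computability.Complexity
open Summit.PneNP.PneNP.Theorems.CliqueExtLowerBound.Negative

variable {ι : Type*}

/-! ## The threshold function -/

/-- The weight (number of ones) of a Boolean vector. [folklore] -/
def wt [Fintype ι] (x : ι → Bool) : ℕ := #(univ.filter fun i => x i = true)

/-- **The threshold function** `Thr_θ(x) = [wt x ≥ θ]`. [folklore] -/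
def thrFn [Fintype ι] (θ : ℕ) (x : ι → Bool) : Bool := decide (θ ≤ wt x)

/-- The threshold function is monotone. [folklore] -/
theorem thrFn_monotone [Fintype ι] (θ : ℕ) : Monotone (thrFn (ι := ι) θ) := by
  intro x y hxy
  unfold thrFn wt
  intro h
  rw [decide_eq_true_iff] at h ⊢
  refine h.trans (card_le_card fun i hi => ?_)
  simp only [mem_filter, mem_univ, true_and] at hi ⊢
  have := hxy i
  rw [hi] at this
  exact this rfl

/-- The weight of the all-`0` vector is `0`. [folklore] -/
theorem wt_false [Fintype ι] : wt (fun _ : ι => false) = 0 := by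
  simp [wt]

/-- The weight of the all-`1` vector is the number of variables. [folklore] -/
theorem wt_true [Fintype ι] : wt (fun _ : ι => true) = Fintype.card ι := by
  simp [wt]

/-- The weight is invariant under renaming the variables along an equivalence. [folklore] -/
theorem wt_comp_equiv [Fintype ι] {ι' : Type*} [Fintype ι'] (e : ι' ≃ ι) (x : ι → Bool) :
    wt (fun t => x (e t)) = wt x := by
  unfold wt
  rw [← Finset.card_map e.toEmbedding]
  congr 1
  ext i
  simp only [mem_map_equiv, mem_filter, mem_univ, true_and]
  constructor
  · intro h; rwa [Equiv.apply_symm_apply] at h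
  · intro h; rwa [Equiv.apply_symm_apply]

/-! ## The counter over `Fin N` -/

section Counter

variable {N : ℕ}

/-- Partial weight: the number of ones among the first `i` inputs. [folklore] -/
def pwt (x : Fin N → Bool) (i : ℕ) : ℕ := #(univ.filter fun t : Fin N => (t : ℕ) < i ∧ x t = true)

/-- No input processed: partial weight `0`. [folklore] -/
theorem pwt_zero (x : Fin N → Bool) : pwt x 0 = 0 := by
  simp [pwt]

/-- One more input: the partial weight grows by the new bit. [folklore] -/
theorem pwt_succ (x : Fin N → Bool) {i : ℕ} (hi : i < N) :
    pwt x (i + 1) = pwt x i + (if x ⟨i, hi⟩ = true then 1 else 0) := by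
  unfold pwt
  have hsplit : (univ.filter fun t : Fin N => (t : ℕ) < i + 1 ∧ x t = true) =
      (univ.filter fun t : Fin N => (t : ℕ) < i ∧ x t = true) ∪
        (if x ⟨i, hi⟩ = true then {⟨i, hi⟩} else ∅) := by
    ext t
    simp only [mem_union, mem_filter, mem_univ, true_and]
    constructor
    · rintro ⟨ht, hx⟩
      rcases Nat.lt_succ_iff_lt_or_eq.1 ht with h | h
      · exact Or.inl ⟨h, hx⟩
      · right
        have : t = ⟨i, hi⟩ := Fin.ext h
        subst this
        simp [hx]
    · rintro (⟨ht, hx⟩ | h)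
      · exact ⟨Nat.lt_succ_of_lt ht, hx⟩
      · split_ifs at h with hx
        · rw [mem_singleton] at h
          subst h
          exact ⟨Nat.lt_succ_self i, hx⟩
        · simp at h
  have hdisj : Disjoint (univ.filter fun t : Fin N => (t : ℕ) < i ∧ x t = true)
      (if x ⟨i, hi⟩ = true then {⟨i, hi⟩} else ∅) := by
    split_ifs
    · simp only [disjoint_singleton_right, mem_filter, mem_univ, true_and, not_and]
      intro h; exact absurd h (lt_irrefl i)
    · exact disjoint_empty_right _
  rw [hsplit, card_union_of_disjoint hdisj]
  split_ifs <;> simp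

/-- All inputs processed: the partial weight is the weight. [folklore] -/
theorem pwt_all (x : Fin N → Bool) : pwt x N = wt x := by
  unfold pwt wt
  congr 1
  ext t
  simp only [mem_filter, mem_univ, true_and, and_iff_right_iff_imp]
  exact fun _ => t.2

/-- The level bits after `i` inputs: `lev θ i x j = [pwt x i ≥ j + 1]` (`j < θ`). [folklore] -/
def lev (θ i : ℕ) (x : Fin N → Bool) (j : Fin θ) : Bool := decide ((j : ℕ) + 1 ≤ pwt x i)

/-- The update of the level bits by one input bit, on the state space `inputs ⊕ levels`:
`ℓ_j ↦ ℓ_j ∨ (ℓ_{j-1} ∧ x_i)` (`ℓ_0 ↦ ℓ_0 ∨ x_i`). [folklore] -/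
def stepFn {θ : ℕ} (i : Fin N) (y : Fin N ⊕ Fin θ → Bool) (j : Fin θ) : Bool :=
  if h : (j : ℕ) = 0 then y (.inr j) || y (.inl i)
  else y (.inr j) || (y (.inr ⟨(j : ℕ) - 1, by omega⟩) && y (.inl i))

/-- **The counter invariant**: one update step computes the next level bits. [folklore] -/
theorem lev_succ {θ i : ℕ} (hi : i < N) (x : Fin N → Bool) (j : Fin θ) :
    lev θ (i + 1) x j = stepFn ⟨i, hi⟩ (Sum.elim x (lev θ i x)) j := by
  unfold stepFn lev
  simp only [Sum.elim_inr, Sum.elim_inl, pwt_succ x hi]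
  rw [Bool.eq_iff_iff]
  by_cases hj : (j : ℕ) = 0
  · rw [dif_pos hj]
    split_ifs with hx
    · simp only [Bool.or_eq_true, decide_eq_true_iff, hx, or_true, iff_true]
      omega
    · rw [Bool.not_eq_true] at hx
      simp only [Bool.or_eq_true, decide_eq_true_iff, hx, Bool.false_eq_true, or_false, add_zero]
  · rw [dif_neg hj]
    split_ifs with hx
    · simp only [Bool.or_eq_true, Bool.and_eq_true, decide_eq_true_iff, hx, and_true]
      omega
    · rw [Bool.not_eq_true] at hx
      simp only [Bool.or_eq_true, Bool.and_eq_true, decide_eq_true_iff, hx, Bool.false_eq_true,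
        and_false, or_false, add_zero]

variable {B : Set GateFn}

/-- One update step costs two gates per level. [folklore] -/
theorem cktSize_stepFn (hB : MonoBasis B) {θ : ℕ} (i : Fin N) :
    CktSize B (fun y : Fin N ⊕ Fin θ → Bool => stepFn i y) (θ * 2) := by
  have h : ∀ j : Fin θ, CktSize B (fun (y : Fin N ⊕ Fin θ → Bool) (_ : Unit) => stepFn i y j) 2 := by
    intro j
    by_cases hj : (j : ℕ) = 0
    · refine ((cktSize_or2' hB (Sum.inr j) (Sum.inl i)).of_le (by norm_num)).congr fun y _ => ?_
      simp [stepFn, hj]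
    · have hj1 : (j : ℕ) - 1 < θ := by omega
      refine ((((CktSize.id B).pair (cktSize_and2' hB (ι := Fin N ⊕ Fin θ)
        (Sum.inr (⟨(j : ℕ) - 1, hj1⟩ : Fin θ)) (Sum.inl i))).comp
          (cktSize_or2' hB (ι := (Fin N ⊕ Fin θ) ⊕ Unit) (Sum.inl (Sum.inr j)) (Sum.inr ()))).of_le
            (by norm_num)).congr fun y _ => ?_
      simp [stepFn, hj]
  have := CktSize.pi_const h
  simpa using this

/-- The level bits after `i ≤ N` inputs cost `θ + i·2θ` gates (the `θ` initial constants `0`, then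
`2θ` per input). [folklore] -/
theorem cktSize_lev (hB : MonoBasis B) (θ : ℕ) :
    ∀ i : ℕ, i ≤ N → CktSize B (fun x : Fin N → Bool => lev θ i x) (θ + i * (θ * 2))
  | 0, _ => by
    have h : ∀ j : Fin θ, CktSize B (fun (_ : Fin N → Bool) (_ : Unit) => false) 1 :=
      fun _ => cktSize_const01 hB false
    have := CktSize.pi_const (f := fun (x : Fin N → Bool) (j : Fin θ) => lev θ 0 x j)
      fun j => (h j).congr fun x _ => by simp [lev, pwt_zero]
    simpa using this
  | i + 1, hi => by
    have hrec := cktSize_lev hB θ i (Nat.le_of_succ_le hi)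
    have h := ((CktSize.id B).pair hrec).comp (cktSize_stepFn hB (θ := θ) ⟨i, hi⟩)
    refine (h.of_le (by ring_nf; omega)).congr fun x j => ?_
    exact (lev_succ hi x j).symm

/-- **The threshold function of `N` ordered inputs** costs `θ + N·2θ` gates over any basis
containing `∧₂, ∨₂, 0, 1` (`1 ≤ θ`). [folklore] -/
theorem cktSize_thrFn_fin (hB : MonoBasis B) {θ : ℕ} (hθ : 1 ≤ θ) :
    CktSize B (fun (x : Fin N → Bool) (_ : Unit) => thrFn θ x) (θ + N * (θ * 2)) := by
  refine ((cktSize_lev hB θ N le_rfl).outMap fun _ : Unit => (⟨θ - 1, by omega⟩ : Fin θ)).congr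
    fun x _ => ?_
  simp only [lev, thrFn, pwt_all]
  congr 1
  exact propext ⟨fun h => by omega, fun h => by omega⟩

end Counter

/-! ## The threshold function of an arbitrary finite set of variables -/

variable [Fintype ι] {B : Set GateFn}

/-- **The threshold function `Thr_θ` of the variables `ι`** costs `θ + |ι|·2θ` gates over any
basis containing `∧₂, ∨₂, 0, 1` (`1 ≤ θ`; inputs renamed along `Fintype.equivFin`). [folklore] -/
theorem cktSize_thrFn (hB : MonoBasis B) {θ : ℕ} (hθ : 1 ≤ θ) :
    CktSize B (fun (x : ι → Bool) (_ : Unit) => thrFn θ x) (θ + Fintype.card ι * (θ * 2)) := by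
  have h := (cktSize_thrFn_fin (N := Fintype.card ι) hB hθ).rewire (Fintype.equivFin ι).symm
  refine h.congr fun x _ => ?_
  show thrFn θ (fun t => x ((Fintype.equivFin ι).symm t)) = thrFn θ x
  unfold thrFn
  rw [wt_comp_equiv]

/-- **Polynomial-size MONOTONE circuits for threshold functions**: for `1 ≤ θ ≤ |ι|` there is a
`{∧₂, ∨₂}`-circuit with at most `θ + |ι|·2θ` gates computing `Thr_θ` (counter over `{∧₂, ∨₂, 0, 1}`,
then constant elimination — `Thr_θ` is not constant in this range). [folklore] -/
theorem exists_monotone_circuit_thrFn [DecidableEq ι] {θ : ℕ} (hθ : 1 ≤ θ)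
    (hθN : θ ≤ Fintype.card ι) :
    ∃ C : Circuit ι, C.IsOver monotoneBasis ∧ C.size ≤ θ + Fintype.card ι * (θ * 2) ∧
      ∀ x, C.eval x = thrFn θ x := by
  obtain ⟨C, hC, hs, he⟩ := (cktSize_thrFn (ι := ι) MonoBasis.monotoneBasis01 hθ).toCircuit
  rcases GateList.const_or_exists_monotone_circuit C.gates C.output (GateList.wf_gates C) hC
      C.wf_output with ⟨b, hb⟩ | ⟨C', hC', hs', he'⟩
  · -- a constant output is impossible: `Thr_θ(0…0) = 0`, `Thr_θ(1…1) = 1`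
    exfalso
    have h0 := hb (fun _ => false)
    have h1 := hb (fun _ => true)
    rw [← GateList.circuit_eval, he] at h0 h1
    have h0' : thrFn θ (fun _ : ι => false) = false := by
      simp only [thrFn, wt_false, decide_eq_false_iff_not, not_le]; omega
    have h1' : thrFn θ (fun _ : ι => true) = true := by
      simp only [thrFn, wt_true, decide_eq_true_iff]; exact hθN
    rw [h0'] at h0; rw [h1'] at h1
    exact Bool.false_ne_true (h0.trans h1.symm)
  · exact ⟨C', hC', hs'.trans hs, fun x => by rw [he' x, ← GateList.circuit_eval, he]⟩

end Summit.PneNP.PneNP.Theorems.NegLimitedDoor.Threshold
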